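import Mathlib
import Summits.Ventures.PercRepro.TriangleCapZoneArith
import Summits.Ventures.PercRepro.TriangleCapStarFamilyNecessity
import Summits.Ventures.PercRepro.TriangleCapStarFamilyZone

/-!
# PercRepro — ONE BELOW THE THRESHOLD IN THE WIDE REGIME `D ≥ 4 r − 2`: THE EXACT BOTTOM IS
`C(t,2) − t (D − 1) + r (D − r) − (r − 1)(r − 2)` (p3, gen 56; part 326)

For `2 ≤ r`, `4 r ≤ D + 2`, `m = D + r − 2`, `t = m D + r`: every graph of the band has
`2 j + 2 t (D − 1) + 2 (r − 1)(r − 2) ≥ t (t − 1) + 2 r (D − r)` (`zone_one_below_bound`) — off `I = r` by the abstract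
residue value (part 325), and at `I = r` by the structure: two partial rows cost `2 (D − 1) ≥ 4 r − 2`; one partial row
is impossible (the row sum is `m D`); no partial row gives exactly `m` active rows, so an inside edge `x x'` (disjoint
rows, `inDeg x + inDeg x' ≤ r + 1`) has `c(x) + c(x') ≤ D + 2 r − 1`, and the column loss of part 325 is `≥ 4 r − 2`.
The bound holds throughout the zone `m ≤ D + r − 2` (only `c(x) + c(x') ≤ m + r + 1 ≤ D + 2 r − 1` is used), so
below the threshold the bottom lies in `[r (D − r) − (r − 1)(r − 2), r (D − r)]` (the bipartite witness of part 307
above); one below the threshold the star family of part 324 attains it: THE BOTTOM THERE IS EXACTLY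
`C(t,2) − t (D − 1) + r (D − r) − (r − 1)(r − 2)` (`zone_one_below_exact`), strictly below the bipartite value for
`r ≥ 3` and equal to it for `r = 2` (the census cells `(4, 18)`, `(5, 27)` of §10dq(h)).  Axioms: standard.
-/

namespace PercRepro

namespace TriangleCap

namespace C047

open Finset

variable {V : Type*} [Fintype V] [DecidableEq V]

/-- **THE LOWER BOUND BELOW THE THRESHOLD, WIDE REGIME:** for `2 ≤ r`, `4 r ≤ D + 2`, `m + 2 ≤ D + r` (the whole zone
below the threshold), `t = m D + r`, every triangle-free `H` with `s` edges, `w` of degree `s − t ≥ 1`, every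
off-degree `≤ D`, at the band value `2 j` has `t (t − 1) + 2 r (D − r) ≤ 2 j + 2 t (D − 1) + 2 (r − 1)(r − 2)`. -/
theorem zone_one_below_bound (H : SimpleGraph V) [DecidableRel H.Adj] (hfree : H.CliqueFree 3) (s m r D j : ℕ)
    (hr : 2 ≤ r) (h4 : 4 * r ≤ D + 2) (hm : m + 2 ≤ D + r) (hs : H.edgeFinset.card = s) (w : V)
    (hw : deg H w + (m * D + r) = s) (hw1 : 1 ≤ deg H w)
    (hj : ∑ v, deg H v * deg H v + 2 * ((m * D + r) * (s - (m * D + r) - 1)) + 2 * j = s * (s + 1))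
    (hD : ∀ v, offDeg H w v ≤ D) :
    (m * D + r) * (m * D + r - 1) + 2 * (r * (D - r)) ≤
      2 * j + 2 * ((m * D + r) * (D - 1)) + 2 * ((r - 1) * (r - 2)) := by
  set t := m * D + r with ht
  have hD0 : 0 < D := by omega
  have h2r : 2 * r ≤ D := by omega
  have hmod : t % D = r := by
    rw [ht, Nat.add_comm, Nat.add_mul_mod_self_right, Nat.mod_eq_of_lt (by omega)]
  have hdef := deficiency_identity_split H hfree s t j D hs w hw hw1 hj hD
  have hoff : (offEdges H w).card = t := by
    have := card_offEdges_add_deg H w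
    omega
  have hatt := attach_add_card_inside H hfree w
  rw [hoff] at hatt
  have hsumcol := sum_offDeg_nonNbrs_eq_add_card_inside H hfree w
  rw [hoff] at hsumcol
  have hsumrow : ∑ y ∈ univ.filter (fun y => H.Adj w y), offDeg H w y = t - (insideEdges H w).card := by
    unfold attach at hatt
    omega
  have hIt : (insideEdges H w).card ≤ t := by omega
  have hcol := sum_mul_sub_ge_phi (nonNbrs H w) (offDeg H w) D (fun x _ => hD x)
  have hrow := sum_mul_sub_ge_phi (univ.filter (fun y => H.Adj w y)) (offDeg H w) D (fun y _ => hD y)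
  rw [hsumcol] at hcol
  rw [hsumrow] at hrow
  by_cases hIr : (insideEdges H w).card = r
  swap
  · have := residue_one_below D t (insideEdges H w).card hD0 hIt (by rw [hmod]; exact hr) (by rw [hmod]; exact h4)
      (by rw [hmod]; exact hIr)
    rw [hmod] at this
    omega
  rw [hIr] at hdef hcol hrow hsumcol hsumrow
  have hphi : phiD D (2 * r) = 2 * r * (D - 2 * r) := phiD_two_mul_of_le D r h2r
  have hphi1 : phiD D (t + r) = 2 * r * (D - 2 * r) := by
    rw [phiD_mod, Nat.add_mod, hmod, Nat.mod_eq_of_lt (by omega : r < D), ← two_mul, ← phiD_mod, hphi]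
  have hbridge : 2 * r + (2 * r * (D - 2 * r) + (4 * r - 2)) + 2 * ((r - 1) * (r - 2)) = 2 * (r * (D - r)) + 2 := by
    obtain ⟨u, rfl⟩ : ∃ u, D = 2 * r + u := ⟨D - 2 * r, by omega⟩
    obtain ⟨r', rfl⟩ : ∃ r', r = r' + 2 := ⟨r - 2, by omega⟩
    have e1 : 2 * (r' + 2) + u - 2 * (r' + 2) = u := by omega
    have e2 : r' + 2 - 1 = r' + 1 := by omega
    have e3 : r' + 2 - 2 = r' := by omega
    have e4 : 2 * (r' + 2) + u - (r' + 2) = r' + 2 + u := by omega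
    have e5 : 4 * (r' + 2) - 2 = 4 * r' + 6 := by omega
    rw [e1, e2, e3, e4, e5]
    ring
  rw [hphi1] at hcol
  -- it suffices that the two deficiencies sum to at least `φ_D(2 r) + 4 r − 2`
  suffices hsuff : 2 * r * (D - 2 * r) + (4 * r - 2) ≤
      ∑ x ∈ nonNbrs H w, offDeg H w x * (D - offDeg H w x) +
        ∑ y ∈ univ.filter (fun y => H.Adj w y), offDeg H w y * (D - offDeg H w y) by
    omega
  set P := (univ.filter (fun y => H.Adj w y)).filter (fun y => 1 ≤ offDeg H w y ∧ offDeg H w y < D) with hP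
  rcases Nat.lt_or_ge P.card 2 with hP2 | hP2
  swap
  · -- two partial rows cost `2 (D − 1) ≥ 4 r − 2`
    obtain ⟨y₁, hy₁, y₂, hy₂, hne⟩ := one_lt_card.mp hP2
    have hsub : ({y₁, y₂} : Finset V) ⊆ univ.filter (fun y => H.Adj w y) := by
      intro y hy
      rw [mem_insert, mem_singleton] at hy
      rcases hy with rfl | rfl
      · exact (mem_filter.mp hy₁).1
      · exact (mem_filter.mp hy₂).1
    have hle := sum_le_sum_of_subset (f := fun y => offDeg H w y * (D - offDeg H w y)) hsub
    rw [sum_pair hne] at hle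
    have c1 := partial_cost D (offDeg H w y₁) (mem_filter.mp hy₁).2.1 (mem_filter.mp hy₁).2.2
    have c2 := partial_cost D (offDeg H w y₂) (mem_filter.mp hy₂).2.1 (mem_filter.mp hy₂).2.2
    omega
  -- at most one partial row: in fact none
  have hrows0 : ∀ y ∈ univ.filter (fun y => H.Adj w y), offDeg H w y = 0 ∨ offDeg H w y = D := by
    rcases Nat.lt_or_ge P.card 1 with h0 | h1
    · intro y hy
      by_contra hne
      rw [not_or] at hne
      have hyP : y ∈ P := mem_filter.mpr ⟨hy, by omega, by have := hD y; omega⟩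
      have := card_pos.mpr ⟨y, hyP⟩
      omega
    · exfalso
      have hc1 : P.card = 1 := by omega
      obtain ⟨y₀, hy₀⟩ := card_eq_one.mp hc1
      have hy₀P : y₀ ∈ P := by
        rw [hy₀]
        exact mem_singleton_self _
      rw [mem_filter] at hy₀P
      have hothers : ∀ y ∈ (univ.filter (fun y => H.Adj w y)).erase y₀, offDeg H w y = 0 ∨ offDeg H w y = D := by
        intro y hy
        rw [mem_erase] at hy
        by_contra hne
        rw [not_or] at hne
        have hyP : y ∈ P := mem_filter.mpr ⟨hy.2, by omega, by have := hD y; omega⟩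
        rw [hy₀, mem_singleton] at hyP
        exact hy.1 hyP
      have hsum := sum_eq_mul_card_of_zero_or ((univ.filter (fun y => H.Adj w y)).erase y₀) (offDeg H w) D hothers
      have hsplit := sum_erase_add (univ.filter (fun y => H.Adj w y)) (offDeg H w) hy₀P.1
      rw [hsumrow, hsum] at hsplit
      have e : t - r = D * m := by
        rw [ht, Nat.add_sub_cancel, Nat.mul_comm]
      rw [e] at hsplit
      obtain ⟨F, hF⟩ : ∃ F, D * F + offDeg H w y₀ = D * m := ⟨_, hsplit⟩
      have hm' : (D * F + offDeg H w y₀) % D = (D * m) % D := by rw [hF]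
      rw [Nat.mul_add_mod, Nat.mod_eq_of_lt hy₀P.2.2, Nat.mul_mod_right] at hm'
      omega
  -- exactly `m` full rows, hence `m` active rows
  have hfull : (univ.filter (fun y => H.Adj w y ∧ offDeg H w y = D)).card = m := by
    have hsum := sum_eq_mul_card_of_zero_or (univ.filter (fun y => H.Adj w y)) (offDeg H w) D hrows0
    rw [hsumrow, filter_filter] at hsum
    have e : t - r = D * m := by
      rw [ht, Nat.add_sub_cancel, Nat.mul_comm]
    rw [e] at hsum
    exact (Nat.eq_of_mul_eq_mul_left hD0 hsum).symm
  have hactive : (univ.filter (fun y => H.Adj w y ∧ 1 ≤ offDeg H w y)).card = m := by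
    rw [← hfull]
    congr 1
    apply filter_congr
    intro y _
    constructor
    · rintro ⟨h1, h1'⟩
      refine ⟨h1, ?_⟩
      rcases hrows0 y (mem_filter.mpr ⟨mem_univ _, h1⟩) with h | h
      · omega
      · exact h
    · rintro ⟨h1, h1'⟩
      exact ⟨h1, by omega⟩
  -- the inside edge and the column loss
  obtain ⟨x, hx, x', hx', hxx'⟩ := exists_adj_nonNbrs H w (by omega)
  have hnb := nbrDeg_add_nbrDeg_le_active H hfree w x x' hx hx' hxx'
  rw [hactive] at hnb
  have hin := inDeg_add_inDeg_le_inside_succ H w x x' hx hx' hxx'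
  rw [hIr] at hin
  have hcx := offDeg_eq_nbrDeg_add_inDeg H w x hx
  have hcx' := offDeg_eq_nbrDeg_add_inDeg H w x' hx'
  have hin1 : 1 ≤ inDeg H w x := by
    unfold inDeg
    exact card_pos.mpr ⟨x', mem_filter.mpr ⟨hx', hxx'⟩⟩
  have hin1' : 1 ≤ inDeg H w x' := by
    unfold inDeg
    exact card_pos.mpr ⟨x, mem_filter.mpr ⟨hx, H.adj_symm hxx'⟩⟩
  have hcolsum : (∑ x ∈ nonNbrs H w, offDeg H w x) % D = (2 * r) % D := by
    rw [hsumcol]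
    have e : t + r = D * m + 2 * r := by
      rw [ht, Nat.mul_comm D m]
      ring
    rw [e, Nat.mul_add_mod]
  have hloss := column_loss (nonNbrs H w) (offDeg H w) D r (by omega) h2r (fun z _ => hD z) x x' hx hx'
    (H.ne_of_adj hxx') (by omega) (by omega) (by omega) hcolsum
  rw [hphi] at hloss
  omega

/-- **THE EXACT BOTTOM ONE BELOW THE THRESHOLD, WIDE REGIME:** for `2 ≤ r`, `4 r ≤ D + 2`, `m + 2 = D + r`,
`t = m D + r`, `m + 1 ≤ ℓ`, `2 t ≤ s`: every graph on `ℓ + 1 + (s − t)` vertices with a vertex of degree `s − t` and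
every off-degree `≤ D` has `t (t − 1) + 2 r (D − r) ≤ 2 j + 2 t (D − 1) + 2 (r − 1)(r − 2)`, and the star family with
`r − 1` inside edges attains it with maximum off-degree exactly `D` — the bottom is
`C(t,2) − t (D − 1) + r (D − r) − (r − 1)(r − 2)`. -/
theorem zone_one_below_exact (s ℓ m r D : ℕ) (hr : 2 ≤ r) (h4 : 4 * r ≤ D + 2) (hm : m + 2 = D + r)
    (hmℓ : m + 1 ≤ ℓ) (hs : 2 * (m * D + r) ≤ s) :
    (∀ (H : SimpleGraph (Fin (ℓ + 1 + (s - (m * D + r))))) [DecidableRel H.Adj], H.CliqueFree 3 →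
      H.edgeFinset.card = s → ∀ w, deg H w + (m * D + r) = s → (∀ v, offDeg H w v ≤ D) →
      ∀ j, ∑ v, deg H v * deg H v + 2 * ((m * D + r) * (s - (m * D + r) - 1)) + 2 * j = s * (s + 1) →
      (m * D + r) * (m * D + r - 1) + 2 * (r * (D - r)) ≤
        2 * j + 2 * ((m * D + r) * (D - 1)) + 2 * ((r - 1) * (r - 2))) ∧
    (∃ (H : SimpleGraph (Fin (ℓ + 1 + (s - (m * D + r))))) (_ : DecidableRel H.Adj), H.CliqueFree 3 ∧
      H.edgeFinset.card = s ∧ ∃ w, deg H w + (m * D + r) = s ∧ (∀ v, offDeg H w v ≤ D) ∧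
        (∃ x, ¬ H.Adj w x ∧ offDeg H w x = D) ∧
        ∃ j, ∑ v, deg H v * deg H v + 2 * ((m * D + r) * (s - (m * D + r) - 1)) + 2 * j = s * (s + 1) ∧
          2 * j + 2 * ((m * D + r) * (D - 1)) + 2 * ((r - 1) * (r - 2)) =
            (m * D + r) * (m * D + r - 1) + 2 * (r * (D - r))) := by
  refine ⟨fun H _ hfree hsH w hw hD' j hj => ?_, zone_one_below_witness s ℓ m r D hr (by omega) hm hmℓ hs⟩
  have hw1 : 1 ≤ deg H w := by omega
  exact zone_one_below_bound H hfree s m r D j hr h4 (by omega) hsH w hw hw1 hj hD'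

/-- **`r = 2`, `D ≥ 6`, `m = D`:** the bottom of the deep sub-band `u = t − D`, `t = D² + 2`, on all graphs is the
bipartite value `C(t,2) − t (D − 1) + 2 (D − 2)` — the census reading of §10dq(h) for `r = 2`, as a theorem. -/
theorem zone_two_exact (s ℓ D : ℕ) (hD : 6 ≤ D) (hmℓ : D + 1 ≤ ℓ) (hs : 2 * (D * D + 2) ≤ s) :
    (∀ (H : SimpleGraph (Fin (ℓ + 1 + (s - (D * D + 2))))) [DecidableRel H.Adj], H.CliqueFree 3 →
      H.edgeFinset.card = s → ∀ w, deg H w + (D * D + 2) = s → (∀ v, offDeg H w v ≤ D) →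
      ∀ j, ∑ v, deg H v * deg H v + 2 * ((D * D + 2) * (s - (D * D + 2) - 1)) + 2 * j = s * (s + 1) →
      (D * D + 2) * (D * D + 2 - 1) + 2 * (2 * (D - 2)) ≤ 2 * j + 2 * ((D * D + 2) * (D - 1))) ∧
    (∃ (H : SimpleGraph (Fin (ℓ + 1 + (s - (D * D + 2))))) (_ : DecidableRel H.Adj), H.CliqueFree 3 ∧
      H.edgeFinset.card = s ∧ ∃ w, deg H w + (D * D + 2) = s ∧ (∀ v, offDeg H w v ≤ D) ∧
        (∃ x, ¬ H.Adj w x ∧ offDeg H w x = D) ∧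
        ∃ j, ∑ v, deg H v * deg H v + 2 * ((D * D + 2) * (s - (D * D + 2) - 1)) + 2 * j = s * (s + 1) ∧
          2 * j + 2 * ((D * D + 2) * (D - 1)) = (D * D + 2) * (D * D + 2 - 1) + 2 * (2 * (D - 2))) := by
  have h := zone_one_below_exact s ℓ D 2 D (by omega) (by omega) (by omega) hmℓ hs
  have e : 2 * ((2 - 1) * (2 - 2)) = 0 := by norm_num
  rw [e] at h
  simp only [add_zero] at h
  exact h

end C047

end TriangleCap

end PercRepro
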